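import Mathlib.Analysis.InnerProductSpace.Projection.FiniteDimensional
import HarnessLib

/-!
# The nearest-plane covering bound in a real inner product space

Cell topic `Summits/ABC/StewartYu` (cell abc-stewartyu, seat p1); namespace
`Summit.ABC.StewartYu.PrincipalLattice` (theorems only, no definition, no named fact). First half of
the Euclidean Mahler basis (`EuclideanMahlerBasis.lean`) behind the sharpening WP-M♭ of the reduction
of `p`-adic linear forms in logarithms of primes to Kummer-free principal generators.

* `norm_sub_starProjection_le_norm` — `‖w − P_K w‖ ≤ ‖w‖`;
* `exists_int_comb_norm_sub_sq_le` — **nearest-plane covering bound** (Babai 1986 §3; the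
  classical `μ(L)² ≤ ¼ ∑ ‖bᵢ‖²`): for any finite family `u₀, …, u_{k−1}` in a real inner product
  space and any `x` in its real span there are integers `nᵢ` with
  `‖x − ∑ nᵢ uᵢ‖² ≤ ¼ ∑ ‖uᵢ‖²` (induction on `k`: round the last coefficient, project the last
  vector onto the span of the others, Pythagoras). No linear independence is needed. (The tree's
  `Literature.Algebra.EuclideanLattices.Babai.norm_residual_le` is the same bound for a linearly
  independent family spanning the whole space; the form here is the one the basis theorem needs.)

## References

* L. Babai, *On Lovász' lattice reduction and the nearest lattice point problem*, Combinatorica 6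
  (1986) 1–13, §3 (nearest plane). [Babai1986]
-/

noncomputable section

open Finset Module Set
open scoped RealInnerProductSpace

namespace Summit.ABC.StewartYu.PrincipalLattice

variable {E : Type*} [NormedAddCommGroup E] [InnerProductSpace ℝ E] [FiniteDimensional ℝ E]

/-! ### The nearest-plane covering bound -/

/-- `‖w − P_K w‖ ≤ ‖w‖` for the orthogonal projection `P_K` onto a subspace `K`. [folklore] -/
theorem norm_sub_starProjection_le_norm (K : Submodule ℝ E) (w : E) :
    ‖w - K.starProjection w‖ ≤ ‖w‖ := by
  rw [← Submodule.starProjection_orthogonal_val]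
  exact Submodule.norm_starProjection_apply_le _ w

/-- **Nearest-plane covering bound** (Babai): for a finite family `u₀, …, u_{k−1}` of a real inner
product space and `x ∈ span_ℝ(u)`, there are integers `nᵢ` with `‖x − ∑ nᵢ uᵢ‖² ≤ ¼ ∑ ‖uᵢ‖²`.
Induction on `k`: write `x = y + t u_{k−1}` with `y ∈ span(u₀,…,u_{k−2})`, round `t` to the
nearest integer `n` (`|t − n| ≤ ½`), split `u_{k−1} = q + r` with `q` in that span and `r ⊥` it
(`‖r‖ ≤ ‖u_{k−1}‖`), apply the induction hypothesis to `y + (t − n) q` and use Pythagoras.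
[cite: Babai1986, §3] -/
theorem exists_int_comb_norm_sub_sq_le :
    ∀ (k : ℕ) (u : Fin k → E) (x : E), x ∈ Submodule.span ℝ (Set.range u) →
      ∃ n : Fin k → ℤ, ‖x - ∑ i, (n i : ℝ) • u i‖ ^ 2 ≤ (∑ i, ‖u i‖ ^ 2) / 4 := by
  intro k
  induction k with
  | zero =>
    intro u x hx
    have hx0 : x = 0 := by
      rw [Set.range_eq_empty u, Submodule.span_empty] at hx
      exact (Submodule.mem_bot ℝ).mp hx
    exact ⟨fun _ => 0, by simp [hx0]⟩
  | succ k ih =>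
    intro u x hx
    obtain ⟨c, hc⟩ := (Submodule.mem_span_range_iff_exists_fun ℝ).mp hx
    -- the prefix family, its span, the part of `x` in it
    set u' : Fin k → E := fun i => u (Fin.castSucc i) with hu'
    set K : Submodule ℝ E := Submodule.span ℝ (Set.range u') with hK
    set y : E := ∑ i : Fin k, c (Fin.castSucc i) • u' i with hy
    have hyK : y ∈ K :=
      Submodule.sum_mem _ fun i _ => Submodule.smul_mem _ _ (Submodule.subset_span ⟨i, rfl⟩)
    have hxdec : x = y + c (Fin.last k) • u (Fin.last k) := by
      rw [← hc, Fin.sum_univ_castSucc]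
    -- round the last coefficient
    set t : ℝ := c (Fin.last k) with ht
    set nk : ℤ := round t with hnk
    set s : ℝ := t - nk with hs
    have hs_abs : |s| ≤ 1 / 2 := abs_sub_round t
    -- orthogonal decomposition of the last vector
    set q : E := K.starProjection (u (Fin.last k)) with hq
    have hqK : q ∈ K := Submodule.starProjection_apply_mem _ _
    have hrK : u (Fin.last k) - q ∈ Kᗮ := Submodule.sub_starProjection_mem_orthogonal _
    have hr_le : ‖u (Fin.last k) - q‖ ≤ ‖u (Fin.last k)‖ := norm_sub_starProjection_le_norm K _
    -- induction hypothesis for `y + s • q ∈ K`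
    obtain ⟨n', hn'⟩ := ih u' (y + s • q) (K.add_mem hyK (K.smul_mem s hqK))
    refine ⟨Fin.snoc n' nk, ?_⟩
    -- the error splits orthogonally
    set a : E := y + s • q - ∑ i, (n' i : ℝ) • u' i with ha
    set b : E := s • (u (Fin.last k) - q) with hb
    have haK : a ∈ K :=
      K.sub_mem (K.add_mem hyK (K.smul_mem s hqK))
        (Submodule.sum_mem _ fun i _ => Submodule.smul_mem _ _ (Submodule.subset_span ⟨i, rfl⟩))
    have hbK : b ∈ Kᗮ := Kᗮ.smul_mem s hrK
    have herr : x - ∑ i, ((Fin.snoc n' nk : Fin (k + 1) → ℤ) i : ℝ) • u i = a + b := by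
      rw [Fin.sum_univ_castSucc, hxdec, ha, hb]
      simp only [Fin.snoc_castSucc, Fin.snoc_last, hu', hs, sub_smul, smul_sub]
      abel
    have hab := Submodule.inner_right_of_mem_orthogonal haK hbK
    have hpy : ‖a + b‖ * ‖a + b‖ = ‖a‖ * ‖a‖ + ‖b‖ * ‖b‖ :=
      norm_add_sq_eq_norm_sq_add_norm_sq_real hab
    have hb_le : ‖b‖ ^ 2 ≤ ‖u (Fin.last k)‖ ^ 2 / 4 := by
      rw [hb, norm_smul, Real.norm_eq_abs, mul_pow]
      have hs2 : |s| ^ 2 ≤ (1 / 2) ^ 2 := pow_le_pow_left₀ (abs_nonneg s) hs_abs 2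
      have hr2 : ‖u (Fin.last k) - q‖ ^ 2 ≤ ‖u (Fin.last k)‖ ^ 2 :=
        pow_le_pow_left₀ (norm_nonneg _) hr_le 2
      calc |s| ^ 2 * ‖u (Fin.last k) - q‖ ^ 2 ≤ (1 / 2) ^ 2 * ‖u (Fin.last k) - q‖ ^ 2 :=
            mul_le_mul_of_nonneg_right hs2 (sq_nonneg _)
        _ ≤ (1 / 2) ^ 2 * ‖u (Fin.last k)‖ ^ 2 := mul_le_mul_of_nonneg_left hr2 (by norm_num)
        _ = ‖u (Fin.last k)‖ ^ 2 / 4 := by ring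
    have ha_le : ‖a‖ ^ 2 ≤ (∑ i : Fin k, ‖u (Fin.castSucc i)‖ ^ 2) / 4 := hn'
    rw [herr, sq, hpy, Fin.sum_univ_castSucc]
    nlinarith [ha_le, hb_le]

end Summit.ABC.StewartYu.PrincipalLattice

end
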